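import Summits.QuantumFields.YangMills.Theorems.FlatTubeReductionRateKappa
import HarnessLib

/-!
# The RELATIVE RATE with the NEAR-PAIR magnetic remainder is `o(λ_b²)` for EVERY fibre radius `t = R = K·β^{-1/2}` with `1 ≤ K ≤ log β`: along the schedule of `…RateKappa`
# (`x = β^{-1/2}`, `T = 9L·R₁ + ε ≤ 46Lxℓ`, `βΓ = |Site|`, `σ = 12L³δ⁴`, `α ≤ A·x·ℓ`) the rate `η_s ≤ C₁δ⁴ℓ² + C₂xℓ⁵` and `κ₀ = β|E|α²(6t+2T)² + 120η_s² ≤ K₁δ⁸ℓ⁴ + K₂x²ℓ¹⁰ ≤ a·λ_b(L³β)²`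
# eventually (route `FlatTubeReduction`, crux K1 `NearFlatRatioLaw` stmt-QuantumFields-24720; seat `ym-line-ftr-p1` g16; rate twin «ratepack»; R2b1 RECORD rung — no summit statement is proved here)

WHY (NOTES g16 «NP-L»; memo `Cruxes/NearFlatRatioLaw/Lines/ratepack-v4-moments-g15.md` §2).  `…RateKappa.eventually_symKappa_le_bareLambda_sq` needs `t = R = β^{-1/2}` EXACTLY because of
lane A's `2·stepActionErr t σ ∋ 2N_pl·1728t²√σ` (`βt²√σ ≍ δ² ≍ λ_b`).  With the differenced remainder of `…OffMagneticNear` (`N_pl(58752t³ + 1401138t⁴ + 10⁷αt²)` instead) every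
`t`-dependent term carries a spare factor `x = β^{-1/2}` or `α ≍ xℓ^{1/2}`: for `t = Kx`, `K ≤ ℓ := btLog β`, the envelope is `η_s ≤ C₁·δ⁴ℓ² + C₂·xℓ⁵` (the `δ⁴ℓ²` from `50σN·K²` with the TRUE
`σ = 12L³δ⁴`), hence `η_s² = O(δ⁸ℓ⁴ + x²ℓ¹⁰) = o(δ⁴) = o(λ_b²)`.  So the truncated-Gaussian profile radius `β^{-1/2}√(C log β)` (or any `K ≤ log β`) is admissible for the dressed
(B-T)-rate brick.
* `symEtaNear_le_atom` (`η_s ≤ C₁δ⁴ℓ² + C₂xℓ⁵`), `symKappaNear_le_atom` (`κ₀ ≤ 240C₁²·δ⁸ℓ⁴ + K₂·x²ℓ¹⁰`), `symEtaNear_nonneg`;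
* `delta_pow_eight_mul_log_pow_le`, `powScale_half_sq_mul_log_pow_ten_le_delta_four` (the two eventual comparisons with `δ⁴`), `symKappaNear_final_step`;
* ★★ `eventually_symKappaNear_le_bareLambda_sq` — for `D ≥ 1`, `A ≥ 0`, thresholds `0 ≤ α ≤ A·x·ℓ` eventually and radii `K` with `1 ≤ K ≤ btLog` eventually: `κ₀ ≤ a·λ_b(L³β)²` eventually.
HONEST FRAMING: real-analysis bookkeeping for a stub of the CONDITIONAL reduction route R2b1; femto rung R2b1 (RECORD label); not infinite volume, not a gap, not Clay.  No defs, no named facts,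
no `sorry`.
-/

set_option autoImplicit false

noncomputable section

open MeasureTheory Filter Topology Real
open scoped BigOperators
open Literature.MathematicalPhysics.QuantumFieldTheory
open Literature.MathematicalPhysics.QuantumLattice

namespace Summit.QuantumFields.YangMills.Theorems.FemtoTransferGap.TwoLattice.ConstTube

open Summit.QuantumFields.YangMills.Theorems.FemtoTransferGap
open Summit.QuantumFields.YangMills.Theorems.FemtoTransferGap.TwoLattice
open Summit.QuantumFields.YangMills.Theorems.FemtoTransferGap.TwoLattice.Avg
open Summit.QuantumFields.YangMills.Theorems.FemtoTransferGap.TwoLattice.Cov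

variable {L : ℕ} [NeZero L]

/-! ## §1 The atoms -/

/-- ★ **Envelope of the near-pair symmetric rate**: with `t = Kx`, `βx² = 1`, `1 ≤ K ≤ ℓ`, `βT² ≤ A_Tℓ²`, `βΓ ≤ N`, `σ ≤ 12L³δ⁴`, `α ≤ A·x·ℓ`, `xℓ ≤ 1`, `x ≤ 1 ≤ ℓ`, `δ ≤ 1`:
`η_s ≤ 600·N_P·L³·δ⁴ℓ² + C₂·xℓ⁵`. [folklore] -/
theorem symEtaNear_le_atom {β δ α T x K Γ σ ℓ AT A N : ℝ} (hβ : 0 ≤ β) (hδ1 : δ ≤ 1) (hℓ : 1 ≤ ℓ) (hx0 : 0 ≤ x) (hx1 : x ≤ 1) (hxℓ : x * ℓ ≤ 1)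
    (hβx : β * x ^ 2 = 1) (hK1 : 1 ≤ K) (hKℓ : K ≤ ℓ)
    (hT2 : β * T ^ 2 ≤ AT * ℓ ^ 2) (hAT : 0 ≤ AT) (hA : 0 ≤ A) (hα0 : 0 ≤ α) (hα : α ≤ A * x * ℓ)
    (hσδ : σ ≤ 12 * (L : ℝ) ^ 3 * δ ^ 4) (hΓ0 : 0 ≤ Γ) (hΓ : β * Γ ≤ N) (hN : 0 ≤ N) :
    β * ((Fintype.card (Edge 3 L) : ℝ) * (558 * α ^ 2 * T ^ 2 + 192 * α * T ^ 2) + 216 * α * δ * Γ) +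
        β / 2 * (100 * σ * (Fintype.card (Plaquette 3 L × Fin 3) : ℝ) * (K * x) ^ 2 + 10080 * α * (Fintype.card (Plaquette 3 L × Fin 3) : ℝ) * (K * x) ^ 2 +
          (Fintype.card (Plaquette 3 L) : ℝ) * (58752 * (K * x) ^ 3 + 1401138 * (K * x) ^ 4 + 10000000 * α * (K * x) ^ 2)) ≤
      (600 * (Fintype.card (Plaquette 3 L × Fin 3) : ℝ) * (L : ℝ) ^ 3) * (δ ^ 4 * ℓ ^ 2) +
        ((Fintype.card (Edge 3 L) : ℝ) * (558 * A ^ 2 * AT + 192 * A * AT) + 216 * A * N + 5040 * A * (Fintype.card (Plaquette 3 L × Fin 3) : ℝ) +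
          (Fintype.card (Plaquette 3 L) : ℝ) * (29376 + 700569 + 5000000 * A)) * (x * ℓ ^ 5) := by
  obtain ⟨E, hEdef⟩ : ∃ E : ℝ, E = (Fintype.card (Edge 3 L) : ℝ) := ⟨_, rfl⟩
  obtain ⟨NP, hNPdef⟩ : ∃ NP : ℝ, NP = (Fintype.card (Plaquette 3 L × Fin 3) : ℝ) := ⟨_, rfl⟩
  obtain ⟨Npl, hNpldef⟩ : ∃ Npl : ℝ, Npl = (Fintype.card (Plaquette 3 L) : ℝ) := ⟨_, rfl⟩
  rw [← hEdef, ← hNPdef, ← hNpldef]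
  have hE : 0 ≤ E := by rw [hEdef]; exact Nat.cast_nonneg _
  have hNP : 0 ≤ NP := by rw [hNPdef]; exact Nat.cast_nonneg _
  have hNpl : 0 ≤ Npl := by rw [hNpldef]; exact Nat.cast_nonneg _
  have hℓ0 : 0 ≤ ℓ := by linarith
  have hK0 : 0 ≤ K := by linarith
  have hxℓ0 : 0 ≤ x * ℓ := by positivity
  have hxℓ5 : 0 ≤ x * ℓ ^ 5 := by positivity
  -- powers of `ℓ ≥ 1`
  have hℓ2 : 1 ≤ ℓ ^ 2 := one_le_pow₀ hℓ
  have hℓ3 : ℓ ≤ ℓ ^ 3 := le_self_pow₀ hℓ (by norm_num)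
  have hℓ35 : ℓ ^ 3 ≤ ℓ ^ 5 := pow_le_pow_right₀ hℓ (by norm_num)
  have hℓ45 : ℓ ^ 4 ≤ ℓ ^ 5 := pow_le_pow_right₀ hℓ (by norm_num)
  have hℓ15 : ℓ ≤ ℓ ^ 5 := le_self_pow₀ hℓ (by norm_num)
  -- `xℓ³ ≤ xℓ⁵`, `x²ℓ⁴ ≤ xℓ³`, `x² ≤ x`
  have hxl3_xl5 : x * ℓ ^ 3 ≤ x * ℓ ^ 5 := mul_le_mul_of_nonneg_left hℓ35 hx0
  have hx2l4 : x ^ 2 * ℓ ^ 4 ≤ x * ℓ ^ 3 := by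
    have : x ^ 2 * ℓ ^ 4 = (x * ℓ) * (x * ℓ ^ 3) := by ring
    rw [this]; exact mul_le_of_le_one_left (by positivity) hxℓ
  have hx2 : x ^ 2 ≤ x := by nlinarith
  -- powers of `K ≤ ℓ`
  have hK2 : K ^ 2 ≤ ℓ ^ 2 := pow_le_pow_left₀ hK0 hKℓ 2
  have hK3 : K ^ 3 ≤ ℓ ^ 3 := pow_le_pow_left₀ hK0 hKℓ 3
  have hK4 : K ^ 4 ≤ ℓ ^ 4 := pow_le_pow_left₀ hK0 hKℓ 4
  -- kinetic terms (as in `symEta_le_atom`, then `xℓ³ ≤ xℓ⁵`)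
  have hα2 : α ^ 2 ≤ (A * x * ℓ) ^ 2 := pow_le_pow_left₀ hα0 hα 2
  have k1 : β * (558 * α ^ 2 * T ^ 2) ≤ 558 * A ^ 2 * AT * (x * ℓ ^ 5) := by
    have h2 : α ^ 2 * (β * T ^ 2) ≤ (A * x * ℓ) ^ 2 * (AT * ℓ ^ 2) := mul_le_mul hα2 hT2 (by positivity) (by positivity)
    have h3 : (A * x * ℓ) ^ 2 * (AT * ℓ ^ 2) = A ^ 2 * AT * (x ^ 2 * ℓ ^ 4) := by ring
    have h4 : A ^ 2 * AT * (x ^ 2 * ℓ ^ 4) ≤ A ^ 2 * AT * (x * ℓ ^ 5) := mul_le_mul_of_nonneg_left (hx2l4.trans hxl3_xl5) (by positivity)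
    have e : β * (558 * α ^ 2 * T ^ 2) = 558 * (α ^ 2 * (β * T ^ 2)) := by ring
    rw [e]; rw [h3] at h2; linarith [h2, h4]
  have k2 : β * (192 * α * T ^ 2) ≤ 192 * A * AT * (x * ℓ ^ 5) := by
    have h2 : α * (β * T ^ 2) ≤ (A * x * ℓ) * (AT * ℓ ^ 2) := mul_le_mul hα hT2 (by positivity) (by positivity)
    have h3 : (A * x * ℓ) * (AT * ℓ ^ 2) = A * AT * (x * ℓ ^ 3) := by ring
    have h4 : A * AT * (x * ℓ ^ 3) ≤ A * AT * (x * ℓ ^ 5) := mul_le_mul_of_nonneg_left hxl3_xl5 (by positivity)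
    have e : β * (192 * α * T ^ 2) = 192 * (α * (β * T ^ 2)) := by ring
    rw [e]; rw [h3] at h2; linarith [h2]
  have k3 : β * (216 * α * δ * Γ) ≤ 216 * A * N * (x * ℓ ^ 5) := by
    have h1 : α * δ ≤ A * x * ℓ := (mul_le_of_le_one_right hα0 hδ1).trans hα
    have h2 : α * δ * (β * Γ) ≤ (A * x * ℓ) * N := mul_le_mul h1 hΓ (by positivity) (by positivity)
    have h3 : A * N * (x * ℓ) ≤ A * N * (x * ℓ ^ 5) := mul_le_mul_of_nonneg_left (mul_le_mul_of_nonneg_left hℓ15 hx0) (by positivity)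
    have e : β * (216 * α * δ * Γ) = 216 * (α * δ * (β * Γ)) := by ring
    have e' : (A * x * ℓ) * N = A * N * (x * ℓ) := by ring
    rw [e]; rw [e'] at h2; linarith [h2, h3]
  -- magnetic terms with `t = Kx`, `β(Kx)² = K²`
  have hβK : β * (K * x) ^ 2 = K ^ 2 := by
    calc β * (K * x) ^ 2 = K ^ 2 * (β * x ^ 2) := by ring
      _ = K ^ 2 := by rw [hβx, mul_one]
  have m1 : β / 2 * (100 * σ * NP * (K * x) ^ 2) ≤ 600 * NP * (L : ℝ) ^ 3 * (δ ^ 4 * ℓ ^ 2) := by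
    have h1 : β / 2 * (100 * σ * NP * (K * x) ^ 2) = 50 * (NP * σ) * (β * (K * x) ^ 2) := by ring
    rw [h1, hβK]
    have h2 : NP * σ ≤ NP * (12 * (L : ℝ) ^ 3 * δ ^ 4) := mul_le_mul_of_nonneg_left hσδ hNP
    have h3 : NP * σ * K ^ 2 ≤ NP * (12 * (L : ℝ) ^ 3 * δ ^ 4) * ℓ ^ 2 := mul_le_mul h2 hK2 (sq_nonneg K) (by positivity)
    linarith [h3]
  have m2 : β / 2 * (10080 * α * NP * (K * x) ^ 2) ≤ 5040 * A * NP * (x * ℓ ^ 5) := by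
    have h1 : β / 2 * (10080 * α * NP * (K * x) ^ 2) = 5040 * (NP * α) * (β * (K * x) ^ 2) := by ring
    rw [h1, hβK]
    have h2 : α * K ^ 2 ≤ (A * x * ℓ) * ℓ ^ 2 := mul_le_mul hα hK2 (sq_nonneg K) (by positivity)
    have h3 : (A * x * ℓ) * ℓ ^ 2 = A * (x * ℓ ^ 3) := by ring
    have h4 : NP * (α * K ^ 2) ≤ NP * (A * (x * ℓ ^ 5)) :=
      mul_le_mul_of_nonneg_left ((h2.trans (le_of_eq h3)).trans (mul_le_mul_of_nonneg_left hxl3_xl5 hA)) hNP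
    linarith [h4]
  have m3 : β / 2 * (Npl * (58752 * (K * x) ^ 3 + 1401138 * (K * x) ^ 4 + 10000000 * α * (K * x) ^ 2)) ≤
      Npl * (29376 + 700569 + 5000000 * A) * (x * ℓ ^ 5) := by
    have e1 : β / 2 * (Npl * (58752 * (K * x) ^ 3 + 1401138 * (K * x) ^ 4 + 10000000 * α * (K * x) ^ 2)) =
        Npl * (29376 * (K ^ 3 * x) + 700569 * (K ^ 4 * x ^ 2) + 5000000 * (α * K ^ 2)) * (β * x ^ 2) := by ring
    rw [e1, hβx, mul_one]
    have a1 : K ^ 3 * x ≤ x * ℓ ^ 5 := by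
      calc K ^ 3 * x ≤ ℓ ^ 3 * x := mul_le_mul_of_nonneg_right hK3 hx0
        _ = x * ℓ ^ 3 := mul_comm _ _
        _ ≤ x * ℓ ^ 5 := hxl3_xl5
    have a2 : K ^ 4 * x ^ 2 ≤ x * ℓ ^ 5 := by
      calc K ^ 4 * x ^ 2 ≤ ℓ ^ 4 * x := mul_le_mul hK4 hx2 (sq_nonneg x) (by positivity)
        _ = x * ℓ ^ 4 := mul_comm _ _
        _ ≤ x * ℓ ^ 5 := mul_le_mul_of_nonneg_left hℓ45 hx0
    have a3 : α * K ^ 2 ≤ A * (x * ℓ ^ 5) := by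
      have h2 : α * K ^ 2 ≤ (A * x * ℓ) * ℓ ^ 2 := mul_le_mul hα hK2 (sq_nonneg K) (by positivity)
      have h3 : (A * x * ℓ) * ℓ ^ 2 = A * (x * ℓ ^ 3) := by ring
      exact (h2.trans (le_of_eq h3)).trans (mul_le_mul_of_nonneg_left hxl3_xl5 hA)
    have h := mul_le_mul_of_nonneg_left (add_le_add (add_le_add (mul_le_mul_of_nonneg_left a1 (by norm_num : (0 : ℝ) ≤ 29376))
      (mul_le_mul_of_nonneg_left a2 (by norm_num : (0 : ℝ) ≤ 700569))) (mul_le_mul_of_nonneg_left a3 (by norm_num : (0 : ℝ) ≤ 5000000))) hNpl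
    linarith [h]
  have esplit : β * (E * (558 * α ^ 2 * T ^ 2 + 192 * α * T ^ 2) + 216 * α * δ * Γ) +
      β / 2 * (100 * σ * NP * (K * x) ^ 2 + 10080 * α * NP * (K * x) ^ 2 + Npl * (58752 * (K * x) ^ 3 + 1401138 * (K * x) ^ 4 + 10000000 * α * (K * x) ^ 2)) =
      E * (β * (558 * α ^ 2 * T ^ 2) + β * (192 * α * T ^ 2)) + β * (216 * α * δ * Γ) +
        (β / 2 * (100 * σ * NP * (K * x) ^ 2) + β / 2 * (10080 * α * NP * (K * x) ^ 2) +
          β / 2 * (Npl * (58752 * (K * x) ^ 3 + 1401138 * (K * x) ^ 4 + 10000000 * α * (K * x) ^ 2))) := by ring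
  rw [esplit]
  have hk : E * (β * (558 * α ^ 2 * T ^ 2) + β * (192 * α * T ^ 2)) ≤ E * (558 * A ^ 2 * AT * (x * ℓ ^ 5) + 192 * A * AT * (x * ℓ ^ 5)) :=
    mul_le_mul_of_nonneg_left (add_le_add k1 k2) hE
  linarith [hk, k3, m1, m2, m3]

/-- ★ **Envelope of the relative rate, near-pair form**: `κ₀ = β|E|α²(6Kx+2T)² + 120η_s² ≤ 240C₁²·(δ⁸ℓ⁴) + (9604|E|L²A² + 240C₂²)·(x²ℓ¹⁰)` given `η_s ≤ C₁δ⁴ℓ² + C₂xℓ⁵`,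
`T ≤ 46Lxℓ`, `K ≤ ℓ`. [folklore] -/
theorem symKappaNear_le_atom {β δ α T x K ℓ A ηs C₁ C₂ : ℝ} (hβ : 0 ≤ β) (hℓ : 1 ≤ ℓ) (hx0 : 0 ≤ x) (hβx : β * x ^ 2 = 1) (hT0 : 0 ≤ T) (hTx : T ≤ 46 * L * x * ℓ)
    (hK0 : 0 ≤ K) (hKℓ : K ≤ ℓ) (hα0 : 0 ≤ α) (hα : α ≤ A * x * ℓ) (hηs0 : 0 ≤ ηs) (hηs : ηs ≤ C₁ * (δ ^ 4 * ℓ ^ 2) + C₂ * (x * ℓ ^ 5)) :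
    β * (Fintype.card (Edge 3 L) : ℝ) * α ^ 2 * (6 * (K * x) + 2 * T) ^ 2 + 120 * ηs ^ 2 ≤
      (240 * C₁ ^ 2) * (δ ^ 8 * ℓ ^ 4) + (9604 * (Fintype.card (Edge 3 L) : ℝ) * (L : ℝ) ^ 2 * A ^ 2 + 240 * C₂ ^ 2) * (x ^ 2 * ℓ ^ 10) := by
  set E := (Fintype.card (Edge 3 L) : ℝ)
  have hE : 0 ≤ E := Nat.cast_nonneg _
  have hL1 : (1 : ℝ) ≤ L := by exact_mod_cast NeZero.one_le
  have hℓ0 : 0 ≤ ℓ := by linarith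
  -- first term: `6Kx + 2T ≤ 98Lxℓ`
  have h6 : 6 * (K * x) + 2 * T ≤ 98 * L * x * ℓ := by
    have h1 : K * x ≤ L * x * ℓ := by
      calc K * x ≤ ℓ * x := mul_le_mul_of_nonneg_right hKℓ hx0
        _ = 1 * x * ℓ := by ring
        _ ≤ L * x * ℓ := mul_le_mul_of_nonneg_right (mul_le_mul_of_nonneg_right hL1 hx0) hℓ0
    nlinarith
  have hsq : (6 * (K * x) + 2 * T) ^ 2 ≤ (98 * L * x * ℓ) ^ 2 := pow_le_pow_left₀ (by positivity) h6 2
  have hα2 : α ^ 2 ≤ (A * x * ℓ) ^ 2 := pow_le_pow_left₀ hα0 hα 2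
  have f1 : β * E * α ^ 2 * (6 * (K * x) + 2 * T) ^ 2 ≤ 9604 * E * (L : ℝ) ^ 2 * A ^ 2 * (x ^ 2 * ℓ ^ 10) := by
    have h1 : β * E * α ^ 2 * (6 * (K * x) + 2 * T) ^ 2 ≤ β * E * (A * x * ℓ) ^ 2 * (98 * L * x * ℓ) ^ 2 :=
      mul_le_mul (mul_le_mul_of_nonneg_left hα2 (by positivity)) hsq (by positivity) (by positivity)
    have h2 : β * E * (A * x * ℓ) ^ 2 * (98 * L * x * ℓ) ^ 2 = 9604 * E * (L : ℝ) ^ 2 * A ^ 2 * (x ^ 2 * ℓ ^ 4) * (β * x ^ 2) := by ring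
    rw [h2, hβx, mul_one] at h1
    have h410 : x ^ 2 * ℓ ^ 4 ≤ x ^ 2 * ℓ ^ 10 := mul_le_mul_of_nonneg_left (pow_le_pow_right₀ hℓ (by norm_num)) (sq_nonneg x)
    nlinarith [mul_le_mul_of_nonneg_left h410 (by positivity : 0 ≤ 9604 * E * (L : ℝ) ^ 2 * A ^ 2)]
  -- second term
  have f2 : ηs ^ 2 ≤ 2 * C₁ ^ 2 * (δ ^ 8 * ℓ ^ 4) + 2 * C₂ ^ 2 * (x ^ 2 * ℓ ^ 10) := by
    have h1 : ηs ^ 2 ≤ (C₁ * (δ ^ 4 * ℓ ^ 2) + C₂ * (x * ℓ ^ 5)) ^ 2 := pow_le_pow_left₀ hηs0 hηs 2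
    have e1 : (δ ^ 4 * ℓ ^ 2) ^ 2 = δ ^ 8 * ℓ ^ 4 := by ring
    have e2 : (x * ℓ ^ 5) ^ 2 = x ^ 2 * ℓ ^ 10 := by ring
    nlinarith [sq_nonneg (C₁ * (δ ^ 4 * ℓ ^ 2) - C₂ * (x * ℓ ^ 5))]
  nlinarith [f1, f2]

/-- The near-pair symmetric rate is nonnegative. [folklore] -/
theorem symEtaNear_nonneg {β δ α T x K Γ σ : ℝ} (hβ : 0 ≤ β) (hδ0 : 0 ≤ δ) (hx0 : 0 ≤ x) (hK0 : 0 ≤ K) (hα0 : 0 ≤ α) (hσ0 : 0 ≤ σ) (hΓ0 : 0 ≤ Γ) :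
    0 ≤ β * ((Fintype.card (Edge 3 L) : ℝ) * (558 * α ^ 2 * T ^ 2 + 192 * α * T ^ 2) + 216 * α * δ * Γ) +
        β / 2 * (100 * σ * (Fintype.card (Plaquette 3 L × Fin 3) : ℝ) * (K * x) ^ 2 + 10080 * α * (Fintype.card (Plaquette 3 L × Fin 3) : ℝ) * (K * x) ^ 2 +
          (Fintype.card (Plaquette 3 L) : ℝ) * (58752 * (K * x) ^ 3 + 1401138 * (K * x) ^ 4 + 10000000 * α * (K * x) ^ 2)) := by
  positivity

/-! ## §2 ★★ Eventually along the schedule: `κ₀ ≤ a·λ_b(L³β)²` for every radius `K·β^{-1/2}`, `1 ≤ K ≤ log β` -/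

/-- `δ⁸ℓ⁴ ≤ δ⁴` at the rate window once `δ⁴ℓ⁴ ≤ 1`. [folklore] -/
theorem delta_pow_eight_mul_log_pow_le {δ ℓ : ℝ} (h : δ ^ 4 * ℓ ^ 4 ≤ 1) : δ ^ 8 * ℓ ^ 4 ≤ δ ^ 4 := by
  have e : δ ^ 8 * ℓ ^ 4 = δ ^ 4 * (δ ^ 4 * ℓ ^ 4) := by ring
  rw [e]; exact mul_le_of_le_one_right (by positivity) h

/-- `x²ℓ¹⁰ ≤ δ⁴` at the rate window once `β^{-1/3}ℓ¹⁰ ≤ (14D/|Site|)⁴` (`x = powScale (1/2)`, `δ = D·recordDelta1 L (1/6)`, `β ≥ 1`). [folklore] -/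
theorem powScale_half_sq_mul_log_pow_ten_le_delta_four {D β : ℝ} (hβ1 : 1 ≤ β)
    (h : powScale (1 / 3) β * btLog β ^ 10 ≤ (14 * D / (Fintype.card (Site 3 L) : ℝ)) ^ 4) :
    powScale (1 / 2) β ^ 2 * btLog β ^ 10 ≤ (D * recordDelta1 L (1 / 6) β) ^ 4 := by
  have hβ0 : 0 ≤ β := by linarith
  have hβpos : 0 < β := by linarith
  have e1 : powScale (1 / 2) β ^ 2 = powScale (2 / 3) β * powScale (1 / 3) β := by
    rw [powScale_eq hβ1, powScale_eq hβ1, powScale_eq hβ1, ← Real.rpow_mul_natCast hβ0, ← Real.rpow_add hβpos,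
      show (-(1 / 2 : ℝ)) * ((2 : ℕ) : ℝ) = -(2 / 3 : ℝ) + -(1 / 3 : ℝ) by norm_num]
  have e16 : powScale (1 / 6) β ^ 4 = powScale (2 / 3) β := by
    rw [powScale_eq hβ1, powScale_eq hβ1, ← Real.rpow_mul_natCast hβ0, show (-(1 / 6 : ℝ)) * ((4 : ℕ) : ℝ) = -(2 / 3 : ℝ) by norm_num]
  have e2 : (D * recordDelta1 L (1 / 6) β) ^ 4 = (14 * D / (Fintype.card (Site 3 L) : ℝ)) ^ 4 * powScale (2 / 3) β := by
    unfold recordDelta1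
    rw [show D * (14 * powScale (1 / 6) β / (Fintype.card (Site 3 L) : ℝ)) = (14 * D / (Fintype.card (Site 3 L) : ℝ)) * powScale (1 / 6) β by ring, mul_pow, e16]
  rw [e1, e2, mul_assoc, mul_comm ((14 * D / (Fintype.card (Site 3 L) : ℝ)) ^ 4)]
  exact mul_le_mul_of_nonneg_left h (powScale_pos _ _).le

/-- `δ⁴ℓ⁴ ≤ 1` at the rate window once `β^{-2/3}ℓ⁴ ≤ (|Site|/(14D))⁴` (`δ⁴ = (14D/|Site|)⁴·β^{-2/3}`). [folklore] -/
theorem delta_four_mul_log_four_le_one {D β : ℝ} (hβ1 : 1 ≤ β) (hD : 0 < D)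
    (h : powScale (2 / 3) β * btLog β ^ 4 ≤ ((Fintype.card (Site 3 L) : ℝ) / (14 * D)) ^ 4) :
    (D * recordDelta1 L (1 / 6) β) ^ 4 * btLog β ^ 4 ≤ 1 := by
  have hβ0 : 0 ≤ β := by linarith
  have hN : (0 : ℝ) < (Fintype.card (Site 3 L) : ℝ) := by exact_mod_cast Fintype.card_pos
  have hc : 0 < 14 * D / (Fintype.card (Site 3 L) : ℝ) := by positivity
  have e16 : powScale (1 / 6) β ^ 4 = powScale (2 / 3) β := by
    rw [powScale_eq hβ1, powScale_eq hβ1, ← Real.rpow_mul_natCast hβ0, show (-(1 / 6 : ℝ)) * ((4 : ℕ) : ℝ) = -(2 / 3 : ℝ) by norm_num]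
  have e2 : (D * recordDelta1 L (1 / 6) β) ^ 4 = (14 * D / (Fintype.card (Site 3 L) : ℝ)) ^ 4 * powScale (2 / 3) β := by
    unfold recordDelta1
    rw [show D * (14 * powScale (1 / 6) β / (Fintype.card (Site 3 L) : ℝ)) = (14 * D / (Fintype.card (Site 3 L) : ℝ)) * powScale (1 / 6) β by ring, mul_pow, e16]
  have hinv : ((Fintype.card (Site 3 L) : ℝ) / (14 * D)) ^ 4 = ((14 * D / (Fintype.card (Site 3 L) : ℝ)) ^ 4)⁻¹ := by
    rw [← inv_pow, inv_div]
  rw [e2, mul_assoc]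
  rw [hinv] at h
  have h2 := mul_le_mul_of_nonneg_left h (pow_pos hc 4).le
  rwa [mul_inv_cancel₀ (pow_pos hc 4).ne'] at h2

/-- Final bookkeeping step: `240C₁²·y₁ + K₂·y₂ ≤ (240C₁² + K₂)c_δ²·Λ²` when `y₁, y₂ ≤ d4 = c_δ²Λ²`, `K₂ ≥ 0`. [folklore] -/
theorem symKappaNear_final_step {C₁ K₂ cδ d4 y₁ y₂ Λ : ℝ} (hK₂ : 0 ≤ K₂) (h1 : y₁ ≤ d4) (h2 : y₂ ≤ d4) (h3 : d4 = cδ ^ 2 * Λ ^ 2) :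
    240 * C₁ ^ 2 * y₁ + K₂ * y₂ ≤ (240 * C₁ ^ 2 + K₂) * cδ ^ 2 * Λ ^ 2 := by
  have h4 := mul_le_mul_of_nonneg_left h2 hK₂
  have h5 := mul_le_mul_of_nonneg_left h1 (by positivity : (0 : ℝ) ≤ 240 * C₁ ^ 2)
  subst h3
  nlinarith [h4, h5, sq_nonneg C₁, sq_nonneg (cδ * Λ)]

/-- ★★ **The near-pair relative rate is `O(λ_b²)` for every fibre radius `K·β^{-1/2}`, `1 ≤ K ≤ log β`**: for `D ≥ 1`, `A ≥ 0`, any threshold family `α` with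
`0 ≤ α β ≤ A·powScale(1/2)β·btLog β` eventually and any radius factor `K` with `1 ≤ K β ≤ btLog β` eventually, along the schedule `δ = D·recordDelta1 L (1/6)`, `t = R = K·powScale (1/2)`,
`T = 9L·btR1 + btEps`, `Γ = btEps·|Site|`, `σ = 12L³δ⁴`, the relative rate `κ₀` of `dressed_fixed_beta_estimate_near` satisfies `κ₀(β) ≤ a·bareLambda(L³β)²` eventually, for an explicit
`a = a(L, D, A)`. [folklore] -/
theorem eventually_symKappaNear_le_bareLambda_sq {D A : ℝ} (hD : 1 ≤ D) (hA : 0 ≤ A) {α K : ℝ → ℝ} (hα0 : ∀ᶠ β : ℝ in atTop, 0 ≤ α β)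
    (hα : ∀ᶠ β : ℝ in atTop, α β ≤ A * powScale (1 / 2) β * btLog β) (hK1 : ∀ᶠ β : ℝ in atTop, 1 ≤ K β) (hKℓ : ∀ᶠ β : ℝ in atTop, K β ≤ btLog β) :
    ∃ a : ℝ, ∀ᶠ β : ℝ in atTop,
      β * (Fintype.card (Edge 3 L) : ℝ) * α β ^ 2 * (6 * (K β * powScale (1 / 2) β) + 2 * (9 * L * btR1 β + btEps β)) ^ 2 +
          120 * (β * ((Fintype.card (Edge 3 L) : ℝ) * (558 * α β ^ 2 * (9 * L * btR1 β + btEps β) ^ 2 + 192 * α β * (9 * L * btR1 β + btEps β) ^ 2) +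
              216 * α β * (D * recordDelta1 L (1 / 6) β) * (btEps β * Fintype.card (Site 3 L))) +
            β / 2 * (100 * ((L : ℝ) ^ 3 * (12 * (D * recordDelta1 L (1 / 6) β) ^ 4)) * (Fintype.card (Plaquette 3 L × Fin 3) : ℝ) * (K β * powScale (1 / 2) β) ^ 2 +
              10080 * α β * (Fintype.card (Plaquette 3 L × Fin 3) : ℝ) * (K β * powScale (1 / 2) β) ^ 2 +
              (Fintype.card (Plaquette 3 L) : ℝ) * (58752 * (K β * powScale (1 / 2) β) ^ 3 + 1401138 * (K β * powScale (1 / 2) β) ^ 4 +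
                10000000 * α β * (K β * powScale (1 / 2) β) ^ 2))) ^ 2 ≤
        a * bareLambda ((L : ℝ) ^ 3 * β) ^ 2 := by
  have hN : (0 : ℝ) < (Fintype.card (Site 3 L) : ℝ) := by exact_mod_cast Fintype.card_pos
  have hD0 : 0 < D := by linarith
  have hc40 : 0 < (14 * D / (Fintype.card (Site 3 L) : ℝ)) ^ 4 := by positivity
  have hc40' : 0 < ((Fintype.card (Site 3 L) : ℝ) / (14 * D)) ^ 4 := by positivity
  -- the constant (in the expanded form the atoms produce)
  obtain ⟨a, ha⟩ : ∃ a : ℝ, a =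
      (240 * (600 * (Fintype.card (Plaquette 3 L × Fin 3) : ℝ) * (L : ℝ) ^ 3) ^ 2 +
          (9604 * (Fintype.card (Edge 3 L) : ℝ) * (L : ℝ) ^ 2 * A ^ 2 +
            240 * ((Fintype.card (Edge 3 L) : ℝ) * (558 * A ^ 2 * (2116 * (L : ℝ) ^ 2) + 192 * A * (2116 * (L : ℝ) ^ 2)) + 216 * A * (Fintype.card (Site 3 L) : ℝ) +
              5040 * A * (Fintype.card (Plaquette 3 L × Fin 3) : ℝ) + (Fintype.card (Plaquette 3 L) : ℝ) * (29376 + 700569 + 5000000 * A)) ^ 2)) *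
        ((14 * D / Fintype.card (Site 3 L)) ^ 2 * L / (2 : ℝ) ^ ((1 : ℝ) / 3)) ^ 2 := ⟨_, rfl⟩
  refine ⟨a, ?_⟩
  have ht10 := (tendsto_powScale_mul_btLog_pow (show (0 : ℝ) < 1 / 3 by norm_num) 10).eventually (eventually_le_nhds hc40)
  have ht4 := (tendsto_powScale_mul_btLog_pow (show (0 : ℝ) < 2 / 3 by norm_num) 4).eventually (eventually_le_nhds hc40')
  filter_upwards [eventually_rate_schedule_facts₂ (L := L) hD, hα0, hα, hK1, hKℓ, ht10, ht4] with β h hα0β hαβ hK1β hKℓβ hℓ10 hℓ4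
  obtain ⟨hβ1, -, hℓ1, -, hδ0, -, hδ1, hx0, hx1, -, hT0, -, hTx, hT2, -, hσ0, -, -, -, hΓ, hxl, hxl1⟩ := h
  have hxℓ : powScale (1 / 2) β * btLog β ≤ 1 := by rw [← hxl]; exact hxl1
  have hβ0 : 0 ≤ β := by linarith
  have hK0 : 0 ≤ K β := by linarith
  have hβx : β * powScale (1 / 2) β ^ 2 = 1 := mul_powScale_half_sq hβ1
  have hΓ0 : 0 ≤ btEps β * (Fintype.card (Site 3 L) : ℝ) := mul_nonneg (powScale_pos _ _).le hN.le
  have hAT : (0 : ℝ) ≤ 2116 * (L : ℝ) ^ 2 := by positivity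
  have hσδ : (L : ℝ) ^ 3 * (12 * (D * recordDelta1 L (1 / 6) β) ^ 4) ≤ 12 * (L : ℝ) ^ 3 * (D * recordDelta1 L (1 / 6) β) ^ 4 := by ring_nf; exact le_rfl
  have hη := symEtaNear_le_atom (L := L) hβ0 hδ1 hℓ1 hx0 hx1 hxℓ hβx hK1β hKℓβ hT2 hAT hA hα0β hαβ hσδ hΓ0 hΓ.le hN.le
  have hη0 := symEtaNear_nonneg (L := L) (T := 9 * L * btR1 β + btEps β) hβ0 hδ0 hx0 hK0 hα0β hσ0 hΓ0
  have hκ := symKappaNear_le_atom (L := L) hβ0 hℓ1 hx0 hβx hT0 hTx hK0 hKℓβ hα0β hαβ hη0 hη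
  rw [ha]
  refine hκ.trans (symKappaNear_final_step (by positivity) ?_ (powScale_half_sq_mul_log_pow_ten_le_delta_four (L := L) hβ1 hℓ10) (scaledDelta1_pow_four_eq (L := L) D hβ1))
  exact delta_pow_eight_mul_log_pow_le (delta_four_mul_log_four_le_one (L := L) hβ1 hD0 hℓ4)

end Summit.QuantumFields.YangMills.Theorems.FemtoTransferGap.TwoLattice.ConstTube

end
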